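import Summits.AtomisticToContinuum.Crystallization.Theorems.ChartedZeroExcessLayeredLatticeLiouvilleZZZC
import Summits.AtomisticToContinuum.Crystallization.Theorems.ChartedZeroExcessLayeredLatticeLiouvilleZZZE

/-!
# (B′.6f) W1 assembly ZZZF — (GL₂) POINTWISE FROM THE PACKAGE BINDERS: the Θ-junction at `rΘ = 145/16` fully assembled (1 theorem, 0 def)

Lineage `stmt-AtomisticToContinuum-26636` (route ChartedPlanarOrder), lens-2 g81, option W1-β of FINDING «IC»; the «ZZP record assembly at r_Θ» item of
the residual of record (critic row 1515).  Imports rider ZZZC (`slabIso_package_reg`, the (B′.5) skeleton without C-side dials) and ZZZE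
(`exists_isBondLabel_of_slabIso_record₂`, tree ZZP at `(r, rI, ℓ, RΘ, Rl) = (145/16, 163/16, 43/2, 13, 21/2)`).

★★ `exists_isBondLabel₂_of_package` — for ONE configuration: the binders of `slabIso_package_reg` at `ε = 10⁻⁴` with `C := placedCrystal L' w' U t`
(global S-chart `hΨ`/`hsurjΨ`, cleanliness, separation / bond gap on both sides, LEMMA C's chart `hΦ` with link closure within `21/2` of `K`, the
container data, REG-out partners `hout` on the moat `(8, 43/2)`, the finiteness source within `43/2`, and the three riders R1 / R2-S / R2-C) + the door
set `hS` and the record cool shadow crystal `hcr` ⟹ `∃ lab, IsBondLabel (1/10000) (145/16) (43/2) S K (placedCrystal L' w' U t) lab`, i.e. the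
pointwise content of (GL₂) at the record dials.  PROOF: `slabIso_package_reg` delivers `Θ, Kread, Φ″, τ″, D″` with its six clauses; clauses 1–6 are, in
order, the `hΦ / hlc / hX₁ / hX₂ / hX₃ / hK` binders of `exists_isBondLabel_of_slabIso_record₂` (finiteness within `145/16` ⊆ within `43/2`).  No dial on
`C`'s two-shell pattern, no `hgoodC`: the inner collar `(8, 145/16]` is not read by anyone (memo «W1-CONSUMERS»).

0 sorry; no new definitions; no new real-side estimate (composition only).
-/

noncomputable section
open scoped RealInnerProductSpace
open Literature.Geometry.DiscreteGeometry (IsTwoShellGoodSet)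

namespace Summit.AtomisticToContinuum.Crystallization.Theorems.ChartedZeroExcessLayeredLatticeLiouville

open Summit.AtomisticToContinuum.Crystallization.Theorems.ChartedPlanarOrderRigidityDoor (E3)
open Summit.AtomisticToContinuum.Crystallization.Theorems.ChartedPlanarOrderCleanScaleP (IsDoorSetP)

/-- ★★ **(GL₂) POINTWISE FROM THE PACKAGE BINDERS** (composition `slabIso_package_reg` ∘ `exists_isBondLabel_of_slabIso_record₂`; see the module
docstring for the binder list). [this file, g81] -/
theorem exists_isBondLabel₂_of_package {aHi δ δS βS δC βC : ℝ} {S K : Set E3} {H : Set E3}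
    {L' : E3 →L[ℝ] E3} {w' : ℤ → E3} {U : E3 ≃ₗᵢ[ℝ] E3} {t : E3}
    {D : Set (ℤ × ℤ × ℤ)} {Ψ Φ : ℤ × ℤ × ℤ → E3} {τS τC : ℤ → Bool} {x₀ : E3}
    (haHi : aHi ≤ 1) (hS : IsDoorSetP aHi δ S)
    (hcr : IsCoolShadowCrystal (17 / 20) (1 / 10000) 5 (1 / 10000) 8 10 (43 / 2) S K H L' w' U t)
    (hΨ : IsBarlowBondChart S Set.univ Ψ τS) (hsurjΨ : ∀ p ∈ S, ∃ x, Ψ x = p)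
    (hclean : ∀ p ∈ S, IsTwoShellGoodSet (1 / 16) (9 / 10) 1 S p)
    (hsepS : ∀ p ∈ S, ∀ p' ∈ S, p ≠ p' → δS ≤ dist p p') (hεS : 2 * (1 / 10000 : ℝ) < δS)
    (hgapS : ∀ p ∈ S, ∀ p' ∈ S, IsBond p p' → dist p p' ≤ βS) (hβS : βS + 2 * (1 / 10000 : ℝ) ≤ 28 / 25) (hβS' : βS ≤ 17 / 16)
    (hΦ : IsBarlowBondChart (placedCrystal L' w' U t) D Φ τC)
    (hsepC : ∀ c ∈ placedCrystal L' w' U t, ∀ c' ∈ placedCrystal L' w' U t, c ≠ c' → δC ≤ dist c c') (hεC : 2 * (1 / 10000 : ℝ) < δC)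
    (hgapC : ∀ c ∈ placedCrystal L' w' U t, ∀ c' ∈ placedCrystal L' w' U t, IsBond c c' → dist c c' ≤ βC)
    (hβC : βC + 2 * (1 / 10000 : ℝ) ≤ 28 / 25)
    (hlc : ∀ y ∈ D, (∃ k ∈ K, dist (Φ y) k < 21 / 2) → ∀ y' : ℤ × ℤ × ℤ, BarlowAdj τC y y' → y' ∈ D)
    (hKS : K ⊆ S) (hKfin : K.Finite) (hKne : K.Nonempty) (hK : ∀ k ∈ K, dist k x₀ ≤ 4)
    (hout : ∀ p ∈ moatIn S K 8 (43 / 2), ∃ y ∈ D, dist p (Φ y) ≤ 1 / 10000)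
    (hfin : Set.Finite {x : ℤ × ℤ × ℤ | ∃ k ∈ K, dist (Ψ x) k ≤ 43 / 2})
    (hR1 : WindowConnected S K Ψ τS) (hR2S : LayerCovered S K Ψ) (hR2C : ReadCovered S K D Ψ Φ (1 / 10000)) :
    ∃ lab : E3 → E3, IsBondLabel (1 / 10000) (145 / 16) (43 / 2) S K (placedCrystal L' w' U t) lab := by
  obtain ⟨Θ, Kread, Φ'', τ'', D'', hΦ'', hlc'', hinj, hiso, hpart, hKread⟩ :=
    slabIso_package_reg hΨ hsurjΨ hclean hsepS hεS hgapS hβS hβS' hΦ hsepC hεC hgapC hβC (by norm_num) hlc hKS hKfin hKne hK hout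
      hfin hR1 hR2S hR2C
  have hfin' : Set.Finite {x : ℤ × ℤ × ℤ | ∃ k ∈ K, dist (Ψ x) k ≤ 145 / 16} :=
    hfin.subset fun x ⟨k, hk, hxk⟩ => ⟨k, hk, hxk.trans (by norm_num)⟩
  exact exists_isBondLabel_of_slabIso_record₂ haHi hS hcr hΨ hsurjΨ hfin' hΦ'' hlc'' hKread hinj hiso hpart

end Summit.AtomisticToContinuum.Crystallization.Theorems.ChartedZeroExcessLayeredLatticeLiouville
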